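import Literature.NumberTheory.Rogawski1990.UnipotentOrbitalMeasuresExistCM   -- ★ p849138 (LH3-p02): RAO-EX; brings `descConj`, `IsLocSmooth`, the CM local carrier `cmDatum … .Local`
import Literature.NumberTheory.Rogawski1990.UnipotentOrbitalIntegralConvergenceRegularCM   -- ★ (C) ED. 3 (this seat): `UnitaryGroup.integrable_descConj_of_isLocSmooth_of_regular_unipotent`
import Literature.NumberTheory.Rogawski1990.UnipotentOrbitalIntegralConvergenceSingularCM  -- ★ (C′) (LH10-p01): `UnitaryGroup.integrable_descConj_of_isLocSmooth_of_transvection`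
import HarnessLib

/-!
# Convergence of the unipotent orbital integrals of `U(Φ₃)(L⁺_v)` at an odd non-split place — the ASSEMBLY of Ranga Rao's clause from its three cases
# (`γ = 1` · regular unipotent · transvection); REHEARSAL: the two non-trivial cases enter as ∀-closed hypotheses until their files are ★

Topic `NumberTheory/Rogawski1990`; namespace `Literature.NumberTheory.Rogawski1990`.  THEOREMS ONLY (no definition, no instance, no notation, no named fact, no `sorry`).
Cell `pub/hodgecm-mathlib`, crux H413 = `stmt-HodgeConjecture-24833`, line LH4 Shalika pay-down of the print row `stub_N6nsShalika` (= ★ def `ShalikaGermExpansionNonsplit`,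
[Rogawski1990, Prop. 8.1.1 p. 112]); organ `stub_ShRao` clause (iii) (skeleton a42538b5 :117) = «RAO-CONV» = HCONV (LH3-p02 RAO-TIE rehearsal 779faa6f360e6109 ll. 36–49);
FILE 4 «RAO-ASSEMBLY» (LH4-plan (g2) DEALER WORDS #22 (b), seat LH7-p01 (g2)).

THE STATEMENT (HCONV; [Rao1972, Thm. p. 505]; [Rogawski1990, §4.9 p. 54, §8.1 p. 112]; [HarishChandra1999AdmissibleDistributions, §3.1 p. 17]).  `G = U(Φ₃)(L⁺_v)` at a finite place
`v` of `L⁺` non-split in `L` (`Subsingleton (PlacesOver L v)`) with `2` a unit; `γ ∈ G` UNIPOTENT (`(γ − 1)³ = 0` in `GL₃(∏_{w∣v} L_w)`); `μ` ANY `G`-invariant measure on `G ⧸ C(γ)`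
finite on compacta.  Then for every `f ∈ C_c^∞(G)` the orbital integrand `y C(γ) ↦ f(y γ y⁻¹)` (★ `descConj`) is `μ`-INTEGRABLE.
THE SPLIT.  `γ = 1`: `C(1) = G`, `G ⧸ C(1)` is ONE POINT (so `μ` is finite) and the integrand is the constant `f(1)` — proved here
(`integrable_descConj_of_eq_one`, generic group).  `(γ − 1)² ≠ 0` (REGULAR unipotent): LH5-p02's `UnitaryGroup.integrable_descConj_of_isLocSmooth_of_regular_unipotent`
(file `UnipotentOrbitalIntegralConvergenceRegularCM`, head text 04:42:02Z).  `(γ − 1)² = 0`, `γ ≠ 1` (TRANSVECTION): F0P3a-p09's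
`UnitaryGroup.integrable_descConj_of_isLocSmooth_of_transvection` (file `UnipotentOrbitalIntegralConvergenceTransvectionCM`, head of record per DEALER WORDS #22 (b)).  In this
REHEARSAL edition the two case theorems are the ∀-closed hypotheses `hregCase` ∕ `hsingCase` (their head texts token for token); the FILE edition replaces them by the imports and
exports the HEAD OF RECORD `UnitaryGroup.integrable_descConj_of_isLocSmooth_of_unipotent` with a one-line body.
HONEST LABEL: HC_CM is proved only modulo the 7 printed citations (2 remaining: hLiu418 = stmt-HodgeConjecture-24832, h413 = stmt-HodgeConjecture-24833) until rung 0 closes; this file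
proves only the trivial class and the case split — count-neutral until the leaf TIE.

## References
* [Rao1972] R. Ranga Rao, *Orbital integrals in reductive groups*, Ann. of Math. (2) 96 (1972) 505–510: Theorem p. 505.
* [Rogawski1990] J. D. Rogawski, *Automorphic Representations of Unitary Groups in Three Variables*, Ann. of Math. Stud. 123 (1990): §4.9 p. 54; §8.1 p. 112; §3.9 Prop. 3.9.1.
* [HarishChandra1999AdmissibleDistributions] Harish-Chandra (DeBacker–Sally), *Admissible Invariant Distributions on Reductive p-adic Groups*, AMS ULS 16 (1999): §3.1 p. 17.
-/

set_option autoImplicit false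

noncomputable section

open MeasureTheory Measure NumberField IsDedekindDomain Topology Filter Set
open Literature.MeasureTheory.Group Literature.NumberTheory.Automorphic Literature.NumberTheory.Automorphic.UnitaryGroup
open scoped Matrix MatrixGroups ValuativeRel

/-! ## §1 The trivial class: `γ = 1` (generic group) -/

namespace Literature.MeasureTheory.Group

section TrivialClass

variable {G : Type*} [Group G]

/-- The centraliser of `1` is everything, so `G ⧸ C(1)` is a single point. [cite: Rogawski1990, §4.9 p. 54] -/
theorem subsingleton_univ_quotient_centralizer_one :
    (univ : Set (G ⧸ Subgroup.centralizer (({(1 : G)} : Set G)))).Subsingleton := by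
  intro a _ b _
  induction a using QuotientGroup.induction_on with
  | H x =>
    induction b using QuotientGroup.induction_on with
    | H y =>
      refine QuotientGroup.eq.2 (Subgroup.mem_centralizer_singleton_iff.2 ?_)
      rw [mul_one, one_mul]

/-- The orbital integrand at `γ = 1` is the constant `f 1`. [cite: Rogawski1990, §4.9 p. 54] -/
theorem descConj_one_eq_const {α : Type*} (f : G → α) :
    descConj (1 : G) (Subgroup.centralizer (({(1 : G)} : Set G))) (fun _ hg => Subgroup.mem_centralizer_singleton_iff.1 hg) f = fun _ => f 1 := by
  funext y
  induction y using QuotientGroup.induction_on with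
  | H x => rw [descConj_mk, mul_one, mul_inv_cancel]

/-- **The Ranga-Rao clause at the trivial class**: for ANY measure on the one-point space `G ⧸ C(1)` which is finite on compacta, every `f : G → ℂ` has an integrable
orbital integrand at `γ = 1` (it is the constant `f 1` on a space of finite mass). [cite: Rao1972, Theorem] [cite: Rogawski1990, §4.9 p. 54] -/
theorem integrable_descConj_of_eq_one [TopologicalSpace G] [MeasurableSpace (G ⧸ Subgroup.centralizer (({(1 : G)} : Set G)))]
    (μ : Measure (G ⧸ Subgroup.centralizer (({(1 : G)} : Set G)))) [IsFiniteMeasureOnCompacts μ] (f : G → ℂ) :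
    Integrable (descConj (1 : G) (Subgroup.centralizer (({(1 : G)} : Set G))) (fun _ hg => Subgroup.mem_centralizer_singleton_iff.1 hg) f) μ := by
  have hfin : μ univ < ⊤ := (subsingleton_univ_quotient_centralizer_one (G := G)).finite.isCompact.measure_lt_top
  haveI : IsFiniteMeasure μ := ⟨hfin⟩
  rw [descConj_one_eq_const]
  exact integrable_const (f 1)

end TrivialClass

end Literature.MeasureTheory.Group

/-! ## §2 The assembly on `U(Φ₃)(L⁺_v)` (REHEARSAL: regular and transvection cases as ∀-closed hypotheses) -/

namespace Literature.NumberTheory.Rogawski1990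

set_option maxHeartbeats 400000 in
-- statement-heavy: two long ∀-closed case texts + the HCONV binders
/-- **RAO-ASSEMBLY (rehearsal edition).**  HCONV — the Ranga-Rao clause for EVERY unipotent `γ ∈ U(Φ₃)(L⁺_v)` at an odd non-split place and EVERY invariant measure finite on
compacta on `G ⧸ C(γ)` — from the three cases: `γ = 1` (§1 `integrable_descConj_of_eq_one`), `(γ − 1)² ≠ 0` (hypothesis `hregCase` = LH5-p02's head
`UnitaryGroup.integrable_descConj_of_isLocSmooth_of_regular_unipotent`, text of 04:42:02Z token for token), `(γ − 1)² = 0 ∧ γ ≠ 1` (hypothesis `hsingCase` = F0P3a-p09's head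
`UnitaryGroup.integrable_descConj_of_isLocSmooth_of_transvection`, HCONV prefix + `(hsing) (hγ1)`).  The conclusion binders ARE the head of record
`UnitaryGroup.integrable_descConj_of_isLocSmooth_of_unipotent` (FILE edition: drop the two hypotheses, import the two files).
[cite: Rao1972, Theorem p. 505] [cite: Rogawski1990, §8.1 p. 112; §4.9 p. 54] [cite: HarishChandra1999AdmissibleDistributions, §3.1 p. 17] -/
theorem UnitaryGroup.integrable_descConj_of_isLocSmooth_of_unipotent_of_cases
    (hregCase : ∀ (L : Type) [Field L] [NumberField L] [IsCMField L] (v : HeightOneSpectrum (𝓞 ↥(maximalRealSubfield L))) (w : UnitaryGroup.PlacesOver L v),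
      Subsingleton (UnitaryGroup.PlacesOver L v) → IsUnit (2 : 𝒪[w.1.adicCompletion L]) →
      ∀ [MeasurableSpace ((cmDatum L 3 (Matrix.of fun i j : Fin 3 => if i.val + j.val + 1 = 3 then (1 : L) else 0)).Local v)] [BorelSpace ((cmDatum L 3 (Matrix.of fun i j : Fin 3 => if i.val + j.val + 1 = 3 then (1 : L) else 0)).Local v)]
        [∀ γ : ((cmDatum L 3 (Matrix.of fun i j : Fin 3 => if i.val + j.val + 1 = 3 then (1 : L) else 0)).Local v), MeasurableSpace (((cmDatum L 3 (Matrix.of fun i j : Fin 3 => if i.val + j.val + 1 = 3 then (1 : L) else 0)).Local v) ⧸ Subgroup.centralizer ({γ} : Set ((cmDatum L 3 (Matrix.of fun i j : Fin 3 => if i.val + j.val + 1 = 3 then (1 : L) else 0)).Local v)))]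
        [∀ γ : ((cmDatum L 3 (Matrix.of fun i j : Fin 3 => if i.val + j.val + 1 = 3 then (1 : L) else 0)).Local v), BorelSpace (((cmDatum L 3 (Matrix.of fun i j : Fin 3 => if i.val + j.val + 1 = 3 then (1 : L) else 0)).Local v) ⧸ Subgroup.centralizer ({γ} : Set ((cmDatum L 3 (Matrix.of fun i j : Fin 3 => if i.val + j.val + 1 = 3 then (1 : L) else 0)).Local v)))],
      ∀ (γ : ((cmDatum L 3 (Matrix.of fun i j : Fin 3 => if i.val + j.val + 1 = 3 then (1 : L) else 0)).Local v)),
        ((γ.val : GL (Fin 3) (UnitaryGroup.LocalRing L v)).val - 1) ^ 3 = 0 →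
        ((γ.val : GL (Fin 3) (UnitaryGroup.LocalRing L v)).val - 1) ^ 2 ≠ 0 →
        ∀ (μ : Measure (((cmDatum L 3 (Matrix.of fun i j : Fin 3 => if i.val + j.val + 1 = 3 then (1 : L) else 0)).Local v) ⧸ (Subgroup.centralizer ({γ} : Set ((cmDatum L 3 (Matrix.of fun i j : Fin 3 => if i.val + j.val + 1 = 3 then (1 : L) else 0)).Local v)))))
          [SMulInvariantMeasure ((cmDatum L 3 (Matrix.of fun i j : Fin 3 => if i.val + j.val + 1 = 3 then (1 : L) else 0)).Local v) (((cmDatum L 3 (Matrix.of fun i j : Fin 3 => if i.val + j.val + 1 = 3 then (1 : L) else 0)).Local v) ⧸ (Subgroup.centralizer ({γ} : Set ((cmDatum L 3 (Matrix.of fun i j : Fin 3 => if i.val + j.val + 1 = 3 then (1 : L) else 0)).Local v)))) μ] [IsFiniteMeasureOnCompacts μ],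
        ∀ f : ((cmDatum L 3 (Matrix.of fun i j : Fin 3 => if i.val + j.val + 1 = 3 then (1 : L) else 0)).Local v) → ℂ, IsLocSmooth f →
          Integrable (descConj γ (Subgroup.centralizer ({γ} : Set ((cmDatum L 3 (Matrix.of fun i j : Fin 3 => if i.val + j.val + 1 = 3 then (1 : L) else 0)).Local v))) (fun _ hg => Subgroup.mem_centralizer_singleton_iff.1 hg) f) μ)
    (hsingCase : ∀ (L : Type) [Field L] [NumberField L] [IsCMField L] (v : HeightOneSpectrum (𝓞 ↥(maximalRealSubfield L))) (w : UnitaryGroup.PlacesOver L v),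
      Subsingleton (UnitaryGroup.PlacesOver L v) → IsUnit (2 : 𝒪[w.1.adicCompletion L]) →
      ∀ [MeasurableSpace ((cmDatum L 3 (Matrix.of fun i j : Fin 3 => if i.val + j.val + 1 = 3 then (1 : L) else 0)).Local v)] [BorelSpace ((cmDatum L 3 (Matrix.of fun i j : Fin 3 => if i.val + j.val + 1 = 3 then (1 : L) else 0)).Local v)]
        [∀ γ : ((cmDatum L 3 (Matrix.of fun i j : Fin 3 => if i.val + j.val + 1 = 3 then (1 : L) else 0)).Local v), MeasurableSpace (((cmDatum L 3 (Matrix.of fun i j : Fin 3 => if i.val + j.val + 1 = 3 then (1 : L) else 0)).Local v) ⧸ Subgroup.centralizer ({γ} : Set ((cmDatum L 3 (Matrix.of fun i j : Fin 3 => if i.val + j.val + 1 = 3 then (1 : L) else 0)).Local v)))]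
        [∀ γ : ((cmDatum L 3 (Matrix.of fun i j : Fin 3 => if i.val + j.val + 1 = 3 then (1 : L) else 0)).Local v), BorelSpace (((cmDatum L 3 (Matrix.of fun i j : Fin 3 => if i.val + j.val + 1 = 3 then (1 : L) else 0)).Local v) ⧸ Subgroup.centralizer ({γ} : Set ((cmDatum L 3 (Matrix.of fun i j : Fin 3 => if i.val + j.val + 1 = 3 then (1 : L) else 0)).Local v)))],
      ∀ (γ : ((cmDatum L 3 (Matrix.of fun i j : Fin 3 => if i.val + j.val + 1 = 3 then (1 : L) else 0)).Local v)),
        ((γ.val : GL (Fin 3) (UnitaryGroup.LocalRing L v)).val - 1) ^ 3 = 0 →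
        ((γ.val : GL (Fin 3) (UnitaryGroup.LocalRing L v)).val - 1) ^ 2 = 0 → γ ≠ 1 →
        ∀ (μ : Measure (((cmDatum L 3 (Matrix.of fun i j : Fin 3 => if i.val + j.val + 1 = 3 then (1 : L) else 0)).Local v) ⧸ (Subgroup.centralizer ({γ} : Set ((cmDatum L 3 (Matrix.of fun i j : Fin 3 => if i.val + j.val + 1 = 3 then (1 : L) else 0)).Local v)))))
          [SMulInvariantMeasure ((cmDatum L 3 (Matrix.of fun i j : Fin 3 => if i.val + j.val + 1 = 3 then (1 : L) else 0)).Local v) (((cmDatum L 3 (Matrix.of fun i j : Fin 3 => if i.val + j.val + 1 = 3 then (1 : L) else 0)).Local v) ⧸ (Subgroup.centralizer ({γ} : Set ((cmDatum L 3 (Matrix.of fun i j : Fin 3 => if i.val + j.val + 1 = 3 then (1 : L) else 0)).Local v)))) μ] [IsFiniteMeasureOnCompacts μ],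
        ∀ f : ((cmDatum L 3 (Matrix.of fun i j : Fin 3 => if i.val + j.val + 1 = 3 then (1 : L) else 0)).Local v) → ℂ, IsLocSmooth f →
          Integrable (descConj γ (Subgroup.centralizer ({γ} : Set ((cmDatum L 3 (Matrix.of fun i j : Fin 3 => if i.val + j.val + 1 = 3 then (1 : L) else 0)).Local v))) (fun _ hg => Subgroup.mem_centralizer_singleton_iff.1 hg) f) μ)
    (L : Type) [Field L] [NumberField L] [IsCMField L] (v : HeightOneSpectrum (𝓞 ↥(maximalRealSubfield L))) (w : UnitaryGroup.PlacesOver L v)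
    (hsub : Subsingleton (UnitaryGroup.PlacesOver L v)) (h2 : IsUnit (2 : 𝒪[w.1.adicCompletion L]))
    [MeasurableSpace ((cmDatum L 3 (Matrix.of fun i j : Fin 3 => if i.val + j.val + 1 = 3 then (1 : L) else 0)).Local v)] [BorelSpace ((cmDatum L 3 (Matrix.of fun i j : Fin 3 => if i.val + j.val + 1 = 3 then (1 : L) else 0)).Local v)]
    [∀ γ : ((cmDatum L 3 (Matrix.of fun i j : Fin 3 => if i.val + j.val + 1 = 3 then (1 : L) else 0)).Local v), MeasurableSpace (((cmDatum L 3 (Matrix.of fun i j : Fin 3 => if i.val + j.val + 1 = 3 then (1 : L) else 0)).Local v) ⧸ Subgroup.centralizer ({γ} : Set ((cmDatum L 3 (Matrix.of fun i j : Fin 3 => if i.val + j.val + 1 = 3 then (1 : L) else 0)).Local v)))]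
    [∀ γ : ((cmDatum L 3 (Matrix.of fun i j : Fin 3 => if i.val + j.val + 1 = 3 then (1 : L) else 0)).Local v), BorelSpace (((cmDatum L 3 (Matrix.of fun i j : Fin 3 => if i.val + j.val + 1 = 3 then (1 : L) else 0)).Local v) ⧸ Subgroup.centralizer ({γ} : Set ((cmDatum L 3 (Matrix.of fun i j : Fin 3 => if i.val + j.val + 1 = 3 then (1 : L) else 0)).Local v)))]
    (γ : ((cmDatum L 3 (Matrix.of fun i j : Fin 3 => if i.val + j.val + 1 = 3 then (1 : L) else 0)).Local v)) (hγ : ((γ.val : GL (Fin 3) (UnitaryGroup.LocalRing L v)).val - 1) ^ 3 = 0)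
    (μ : Measure (((cmDatum L 3 (Matrix.of fun i j : Fin 3 => if i.val + j.val + 1 = 3 then (1 : L) else 0)).Local v) ⧸ (Subgroup.centralizer ({γ} : Set ((cmDatum L 3 (Matrix.of fun i j : Fin 3 => if i.val + j.val + 1 = 3 then (1 : L) else 0)).Local v)))))
    [SMulInvariantMeasure ((cmDatum L 3 (Matrix.of fun i j : Fin 3 => if i.val + j.val + 1 = 3 then (1 : L) else 0)).Local v) (((cmDatum L 3 (Matrix.of fun i j : Fin 3 => if i.val + j.val + 1 = 3 then (1 : L) else 0)).Local v) ⧸ (Subgroup.centralizer ({γ} : Set ((cmDatum L 3 (Matrix.of fun i j : Fin 3 => if i.val + j.val + 1 = 3 then (1 : L) else 0)).Local v)))) μ] [IsFiniteMeasureOnCompacts μ]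
    (f : ((cmDatum L 3 (Matrix.of fun i j : Fin 3 => if i.val + j.val + 1 = 3 then (1 : L) else 0)).Local v) → ℂ) (hf : IsLocSmooth f) :
    Integrable (descConj γ (Subgroup.centralizer ({γ} : Set ((cmDatum L 3 (Matrix.of fun i j : Fin 3 => if i.val + j.val + 1 = 3 then (1 : L) else 0)).Local v))) (fun _ hg => Subgroup.mem_centralizer_singleton_iff.1 hg) f) μ := by
  by_cases hγ1 : γ = 1
  · subst hγ1
    exact Literature.MeasureTheory.Group.integrable_descConj_of_eq_one μ f
  · by_cases hreg : ((γ.val : GL (Fin 3) (UnitaryGroup.LocalRing L v)).val - 1) ^ 2 = 0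
    · exact hsingCase L v w hsub h2 γ hγ hreg hγ1 μ f hf
    · exact hregCase L v w hsub h2 γ hγ hreg μ f hf


/-! ## §3 (ED. 2) THE HEAD OF RECORD — HCONV for every unipotent class, from the three cases -/

set_option maxHeartbeats 400000 in
-- statement-heavy: the HCONV binders
/-- **RANGA-RAO'S CLAUSE FOR `U(Φ₃)(L⁺_v)` AT AN ODD NON-SPLIT PLACE — THE HEAD OF RECORD `stub_RaoConv` ∕ HCONV.**  For every UNIPOTENT `γ ∈ G = U(Φ₃)(L⁺_v)` (`(γ − 1)³ = 0`),
every `G`-invariant measure `μ` on `G ⧸ C(γ)` finite on compacta and every `f ∈ C_c^∞(G)`, the orbital integrand `y C(γ) ↦ f(y γ y⁻¹)` is `μ`-integrable.  Proof = the three-way split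
`UnitaryGroup.integrable_descConj_of_isLocSmooth_of_unipotent_of_cases` (ED. 1: the class `γ = 1` inside) fed with the two case theorems of record: REGULAR `(γ − 1)² ≠ 0` — ★
`UnitaryGroup.integrable_descConj_of_isLocSmooth_of_regular_unipotent` ((C) `UnipotentOrbitalIntegralConvergenceRegularCM`: normal form `u(1, −1∕2)` + shells (A) LH5-p02 + shell sum (B)
LH4-p03 + transport ★ p849303); TRANSVECTION `(γ − 1)² = 0`, `γ ≠ 1` — ★ `UnitaryGroup.integrable_descConj_of_isLocSmooth_of_transvection` ((C′) `UnipotentOrbitalIntegralConvergenceSingularCM`,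
LH10-p01 over F0P3a-p09's ★ p849314 at the corner base point).  [cite: Rao1972, Theorem p. 505] [cite: Rogawski1990, §8.1 p. 112; §4.9 p. 54; §3.9 Prop. 3.9.1 p. 32]
[cite: HarishChandra1999AdmissibleDistributions, §3.1 p. 17] -/
theorem UnitaryGroup.integrable_descConj_of_isLocSmooth_of_unipotent
    (L : Type) [Field L] [NumberField L] [IsCMField L] (v : HeightOneSpectrum (𝓞 ↥(maximalRealSubfield L))) (w : UnitaryGroup.PlacesOver L v)
    (hsub : Subsingleton (UnitaryGroup.PlacesOver L v)) (h2 : IsUnit (2 : 𝒪[w.1.adicCompletion L]))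
    [MeasurableSpace ((cmDatum L 3 (Matrix.of fun i j : Fin 3 => if i.val + j.val + 1 = 3 then (1 : L) else 0)).Local v)] [BorelSpace ((cmDatum L 3 (Matrix.of fun i j : Fin 3 => if i.val + j.val + 1 = 3 then (1 : L) else 0)).Local v)]
    [∀ γ : ((cmDatum L 3 (Matrix.of fun i j : Fin 3 => if i.val + j.val + 1 = 3 then (1 : L) else 0)).Local v), MeasurableSpace (((cmDatum L 3 (Matrix.of fun i j : Fin 3 => if i.val + j.val + 1 = 3 then (1 : L) else 0)).Local v) ⧸ Subgroup.centralizer ({γ} : Set ((cmDatum L 3 (Matrix.of fun i j : Fin 3 => if i.val + j.val + 1 = 3 then (1 : L) else 0)).Local v)))]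
    [∀ γ : ((cmDatum L 3 (Matrix.of fun i j : Fin 3 => if i.val + j.val + 1 = 3 then (1 : L) else 0)).Local v), BorelSpace (((cmDatum L 3 (Matrix.of fun i j : Fin 3 => if i.val + j.val + 1 = 3 then (1 : L) else 0)).Local v) ⧸ Subgroup.centralizer ({γ} : Set ((cmDatum L 3 (Matrix.of fun i j : Fin 3 => if i.val + j.val + 1 = 3 then (1 : L) else 0)).Local v)))]
    (γ : ((cmDatum L 3 (Matrix.of fun i j : Fin 3 => if i.val + j.val + 1 = 3 then (1 : L) else 0)).Local v)) (hγ : ((γ.val : GL (Fin 3) (UnitaryGroup.LocalRing L v)).val - 1) ^ 3 = 0)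
    (μ : Measure (((cmDatum L 3 (Matrix.of fun i j : Fin 3 => if i.val + j.val + 1 = 3 then (1 : L) else 0)).Local v) ⧸ (Subgroup.centralizer ({γ} : Set ((cmDatum L 3 (Matrix.of fun i j : Fin 3 => if i.val + j.val + 1 = 3 then (1 : L) else 0)).Local v)))))
    [SMulInvariantMeasure ((cmDatum L 3 (Matrix.of fun i j : Fin 3 => if i.val + j.val + 1 = 3 then (1 : L) else 0)).Local v) (((cmDatum L 3 (Matrix.of fun i j : Fin 3 => if i.val + j.val + 1 = 3 then (1 : L) else 0)).Local v) ⧸ (Subgroup.centralizer ({γ} : Set ((cmDatum L 3 (Matrix.of fun i j : Fin 3 => if i.val + j.val + 1 = 3 then (1 : L) else 0)).Local v)))) μ] [IsFiniteMeasureOnCompacts μ]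
    (f : ((cmDatum L 3 (Matrix.of fun i j : Fin 3 => if i.val + j.val + 1 = 3 then (1 : L) else 0)).Local v) → ℂ) (hf : IsLocSmooth f) :
    Integrable (descConj γ (Subgroup.centralizer ({γ} : Set ((cmDatum L 3 (Matrix.of fun i j : Fin 3 => if i.val + j.val + 1 = 3 then (1 : L) else 0)).Local v))) (fun _ hg => Subgroup.mem_centralizer_singleton_iff.1 hg) f) μ := by
  refine UnitaryGroup.integrable_descConj_of_isLocSmooth_of_unipotent_of_cases ?_ ?_ L v w hsub h2 γ hγ μ f hf
  · intro L _ _ _ v w hsub h2 _ _ _ _ γ hγ hreg μ _ _ f hf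
    exact UnitaryGroup.integrable_descConj_of_isLocSmooth_of_regular_unipotent L v w hsub h2 γ hγ hreg μ f hf
  · intro L _ _ _ v w hsub _ _ _ _ _ γ _ hsing hγ1 μ _ _ f hf
    exact UnitaryGroup.integrable_descConj_of_isLocSmooth_of_transvection L v w hsub γ hsing hγ1 μ f hf

end Literature.NumberTheory.Rogawski1990

end
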